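import Literature.AlgebraicGeometry.Resolution.FormalCoordinateChange
import Literature.RingTheory.MvPowerSeries.MaximalIdealPow
import Mathlib.RingTheory.MvPowerSeries.Trunc
import Mathlib.RingTheory.MvPowerSeries.Substitution
import HarnessLib

/-!
# Initial forms of power series under linear changes of coordinates, and along a smooth centre
# (Mulay 1983, 2.6 — the choice of the Weierstrass direction)

Topic: `Literature/AlgebraicGeometry/Resolution`. Fifth brick of the discharge of the named fact
`Mulay1983_codimTwoHyperplanar` (`Mulay1983Hyperplanarity.lean`); S. B. Mulay, *Equimultiplicity and
hyperplanarity*, Proc. Amer. Math. Soc. **89** (1983) 407–413 (lit key `paper:url-29aeafb0cf6c`).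
Mulay 2.6 (p. 410): «there exists a basis `(X₁, …, X_n)` of `m(R)` such that `FR ⊄ (X₁^{d+1}, X₂, …, X_n)R`.
By Cohen's structure theorem `R = K⟦X₁, …, X_n⟧` … Let `S = K⟦X₂, …, X_n⟧` and `z = X₁`.» — the choice of
a direction in which the series is regular of order `d = ord F`, obtained from Abhyankar (4.13) over an
infinite residue field. For `R = L⟦x₁, …, x_n⟧` the degree-`d` initial form is the polynomial
`truncTotal (d+1) g` (all lower coefficients vanish) and a LINEAR change of coordinates
`x_i ↦ Σ_j B_{ij} x_j` (the tree's `FormalCoordChange.linSubst`) is enough; we prove, with no new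
definitions:

* `truncTotal_mul_of_le_order`, `eval_truncTotal_two` — initial forms are
  multiplicative (`in(pF) = in(p) in(F)`, via Mathlib's `homogeneousComponent_mul_of_le_order`) and the
  initial forms of constants / of elements of `𝔪` evaluate to the constant term / the linear part;
* `coeff_single_subst_linSubst` — **the coefficient of `x_t^m` after the linear substitution `B` is the
  value of the degree-`m` initial form at the `t`-th column of `B`** (so `g(Bx)` is `x_t`-regular of order
  `m` iff `in(g)(B e_t) ≠ 0`: Mulay's «`FR ⊄ (X₁^{d+1}, X₂, …, X_n)`»);
* `eval_truncTotal_add_eq_of_mem_pow` — **along a centre `(p₁, p₂) ⊆ 𝔪` the initial form of any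
  `F ∈ (p₁, p₂)^m` is a polynomial in the linear parts of `p₁, p₂`**: its value at `x + n` equals its
  value at `x` whenever the linear parts of `p₁, p₂` vanish at `n` (for an equimultiple centre this is
  Hironaka's «`in(F) ∈ k[in P]`»; Mulay uses it through 2.6/3.4);

No statement of H. Hironaka's 2017 manuscript is involved. AI formalisation; weaker than expert
review.

## References
* S. B. Mulay, *Equimultiplicity and hyperplanarity*, Proc. Amer. Math. Soc. 89 (1983) 407–413, 2.6
  (choice of the Weierstrass direction) and §4. [Mulay1983]
* S. S. Abhyankar, *Resolution of singularities of embedded algebraic surfaces* (1966), (4.13) — cited by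
  Mulay 2.6 for the generic direction. Background only.
-/

noncomputable section

namespace Literature.AlgebraicGeometry.Resolution

namespace Mulay1983

open IsLocalRing Literature.RingTheory.MvPowerSeries

universe u v

variable {L : Type u} [Field L] {σ : Type v} [Finite σ]

/-! ## 1. Initial forms: `truncTotal (m+1)` of a series of order `≥ m` -/

/-- For a series `F` of order `≥ m`, the polynomial `truncTotal (m+1) F` is its degree-`m`
homogeneous component. [folklore] -/
private theorem coe_truncTotal_eq_homogeneousComponent {m : ℕ} {F : MvPowerSeries σ L}
    (hF : (m : ℕ∞) ≤ F.order) :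
    ((MvPowerSeries.truncTotal (m + 1) F : MvPolynomial σ L) : MvPowerSeries σ L) =
      MvPowerSeries.homogeneousComponent m F := by
  classical
  ext e
  rw [MvPolynomial.coeff_coe, MvPowerSeries.coeff_truncTotal_eq_ite, MvPowerSeries.coeff_homogeneousComponent]
  by_cases he : e.degree = m
  · rw [if_pos he, if_pos (by omega)]
  · rw [if_neg he]
    split_ifs with hlt
    · exact MvPowerSeries.coeff_of_lt_order (lt_of_lt_of_le (by exact_mod_cast (by omega : e.degree < m)) hF)
    · rfl

/-- **Initial forms are multiplicative** (the order function of a regular local ring is a valuation and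
`gr_𝔪` is a domain: Zariski–Samuel VIII §1, Thm. 1 and its proof): for `p` of order `≥ a` and `F` of
order `≥ b`, `truncTotal (a+b+1) (p F) = truncTotal (a+1) p · truncTotal (b+1) F` in `L⟦x⟧`.
[cite: ZariskiSamuel1960, Ch. VIII §1 Thm. 1 (proof: initial forms multiply)] -/
theorem truncTotal_mul_of_le_order {a b : ℕ} {p F : MvPowerSeries σ L}
    (hp : (a : ℕ∞) ≤ p.order) (hF : (b : ℕ∞) ≤ F.order) :
    MvPowerSeries.truncTotal (a + b + 1) (p * F) =
      MvPowerSeries.truncTotal (a + 1) p * MvPowerSeries.truncTotal (b + 1) F := by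
  apply MvPolynomial.coe_injective
  change ((MvPowerSeries.truncTotal (a + b + 1) (p * F) : MvPolynomial σ L) : MvPowerSeries σ L) =
    ((MvPowerSeries.truncTotal (a + 1) p * MvPowerSeries.truncTotal (b + 1) F : MvPolynomial σ L) :
      MvPowerSeries σ L)
  have hpF : ((a + b : ℕ) : ℕ∞) ≤ (p * F).order :=
    le_trans (by push_cast; exact add_le_add hp hF) MvPowerSeries.le_order_mul
  rw [MvPolynomial.coe_mul, coe_truncTotal_eq_homogeneousComponent hp,
    coe_truncTotal_eq_homogeneousComponent hF, coe_truncTotal_eq_homogeneousComponent hpF,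
    MvPowerSeries.homogeneousComponent_mul_of_le_order hp hF]

/-- The initial form of order `0` is the constant term. [folklore] -/
private theorem eval_truncTotal_one (r : MvPowerSeries σ L) (x : σ → L) :
    MvPolynomial.eval x (MvPowerSeries.truncTotal 1 r) = MvPowerSeries.constantCoeff r := by
  classical
  have : MvPowerSeries.truncTotal 1 r = MvPolynomial.C (MvPowerSeries.constantCoeff r) := by
    ext e
    rw [MvPowerSeries.coeff_truncTotal_eq_ite, MvPolynomial.coeff_C]
    by_cases he : e = 0
    · subst he; simp
    · have : ¬ e.degree < 1 := fun h => he ((Finsupp.degree_eq_zero_iff e).mp (by omega))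
      rw [if_neg this, if_neg (Ne.symm he)]
  rw [this, MvPolynomial.eval_C]

/-- The initial form of an element of `𝔪` is its linear part: `truncTotal 2 p` evaluates at `x` to
`Σ_s [x_s]p · x_s` (Zariski–Samuel VIII §1: the initial form of an element of order `1` is its image in
`𝔪/𝔪² = k·x₁ ⊕ ⋯ ⊕ k·x_n`). [cite: ZariskiSamuel1960, Ch. VIII §1 (initial forms of elements of order one)] -/
theorem eval_truncTotal_two {p : MvPowerSeries σ L} (hp : MvPowerSeries.constantCoeff p = 0) (x : σ → L) :
    MvPolynomial.eval x (MvPowerSeries.truncTotal 2 p) =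
      ∑ᶠ s : σ, MvPowerSeries.coeff (Finsupp.single s 1) p * x s := by
  classical
  haveI := Fintype.ofFinite σ
  have hpoly : MvPowerSeries.truncTotal 2 p =
      ∑ s : σ, MvPolynomial.monomial (Finsupp.single s 1) (MvPowerSeries.coeff (Finsupp.single s 1) p) := by
    ext e
    rw [MvPowerSeries.coeff_truncTotal_eq_ite, MvPolynomial.coeff_sum]
    simp_rw [MvPolynomial.coeff_monomial]
    by_cases he : e.degree < 2
    · rw [if_pos he]
      rcases FormalCoordChange.eq_zero_or_single_of_degree_lt_two e he with rfl | ⟨i, rfl⟩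
      · rw [MvPowerSeries.coeff_zero_eq_constantCoeff_apply, hp]
        symm
        refine Finset.sum_eq_zero fun s _ => ?_
        rw [if_neg (Finsupp.single_ne_zero.mpr one_ne_zero)]
      · rw [Finset.sum_eq_single i]
        · rw [if_pos rfl]
        · intro s _ hsi
          rw [if_neg (fun h => hsi ((Finsupp.single_left_inj one_ne_zero).mp h))]
        · intro h; exact absurd (Finset.mem_univ i) h
    · rw [if_neg he]
      symm
      refine Finset.sum_eq_zero fun s _ => ?_
      rw [if_neg]
      rintro rfl
      exact he (by simp)
  rw [hpoly, map_sum, finsum_eq_sum_of_fintype]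
  refine Finset.sum_congr rfl fun s _ => ?_
  rw [MvPolynomial.eval_monomial]
  simp

/-! ## 2. Coefficients of `x_t^m` after a linear substitution -/

/-- For a homogeneous polynomial `q` of degree `m`, the coefficient of `x_t^m` is the value of `q` at
the `t`-th standard basis vector. [folklore] -/
private theorem eval_single_one_eq_coeff {n : ℕ} {q : MvPolynomial (Fin n) L} {m : ℕ}
    (hq : q.IsHomogeneous m) (t : Fin n) :
    MvPolynomial.eval (Pi.single t 1) q = MvPolynomial.coeff (Finsupp.single t m) q := by
  classical
  -- the monomial `x^e` at `e_t` is `1` if `e` is supported on `t`, else `0`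
  have hprod : ∀ e : Fin n →₀ ℕ, (∏ i, (Pi.single t (1 : L) : Fin n → L) i ^ e i) =
      if (∀ i, i ≠ t → e i = 0) then 1 else 0 := by
    intro e
    split_ifs with h
    · refine Finset.prod_eq_one fun i _ => ?_
      by_cases hit : i = t
      · subst hit; simp
      · rw [h i hit, pow_zero]
    · push Not at h
      obtain ⟨i, hit, hi⟩ := h
      exact Finset.prod_eq_zero (Finset.mem_univ i) (by rw [Pi.single_eq_of_ne hit, zero_pow hi])
  -- for `e` of degree `m`: supported on `t` iff `e = single t m`
  have hsupp : ∀ e : Fin n →₀ ℕ, e ∈ q.support → ((∀ i, i ≠ t → e i = 0) ↔ e = Finsupp.single t m) := by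
    intro e he
    have hdeg : e.degree = m := by
      have := hq (MvPolynomial.mem_support_iff.mp he)
      rw [← this, Finsupp.degree_eq_weight_one]; rfl
    constructor
    · intro h
      have h1 : e = Finsupp.single t (e t) := by
        rw [Finsupp.eq_single_iff]
        refine ⟨fun i hi => ?_, rfl⟩
        rw [Finset.mem_singleton]
        by_contra hit
        exact (Finsupp.mem_support_iff.mp hi) (h i hit)
      have h2 : e t = m := by
        have := congrArg Finsupp.degree h1
        rw [hdeg, Finsupp.degree_single] at this
        exact this.symm
      rw [h1, h2]
    · rintro rfl i hit
      exact Finsupp.single_eq_of_ne hit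
  rw [MvPolynomial.eval_eq']
  calc ∑ d ∈ q.support, MvPolynomial.coeff d q * ∏ i, (Pi.single t (1 : L) : Fin n → L) i ^ d i
      = ∑ d ∈ q.support, (if d = Finsupp.single t m then MvPolynomial.coeff d q else 0) := by
        refine Finset.sum_congr rfl fun d hd => ?_
        rw [hprod d]
        by_cases h : ∀ i, i ≠ t → d i = 0
        · rw [if_pos h, mul_one, if_pos ((hsupp d hd).mp h)]
        · rw [if_neg h, mul_zero, if_neg (fun h' => h ((hsupp d hd).mpr h'))]
    _ = MvPolynomial.coeff (Finsupp.single t m) q := by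
        rw [Finset.sum_ite_eq']
        split_ifs with h
        · rfl
        · exact (MvPolynomial.notMem_support_iff.mp h).symm

/-- **The coefficient of `x_t^m` after a linear change of coordinates** (Mulay 2.6 «`FR ⊄ (X₁^{d+1},
X₂, …, X_n)R`» = regularity of order `d` in the direction `X₁`): if all coefficients of `h ∈ L⟦x⟧` of
degree `< m` vanish, then the coefficient of `x_t^m` in `h(Bx)` (`FormalCoordChange.linSubst B`) is the
value of the degree-`m` initial form `truncTotal (m+1) h` at the `t`-th column of `B`.
[cite: Mulay1983, 2.6 p. 410] -/
theorem coeff_single_subst_linSubst {n : ℕ} (B : Matrix (Fin n) (Fin n) L) {h : MvPowerSeries (Fin n) L}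
    {m : ℕ} (hh : ∀ e : Fin n →₀ ℕ, e.degree < m → MvPowerSeries.coeff e h = 0) (t : Fin n) :
    MvPowerSeries.coeff (Finsupp.single t m) (MvPowerSeries.subst (FormalCoordChange.linSubst B) h) =
      MvPolynomial.eval (fun s => B s t) (MvPowerSeries.truncTotal (m + 1) h) := by
  classical
  set q : MvPolynomial (Fin n) L := MvPowerSeries.truncTotal (m + 1) h with hqdef
  have hsub := FormalCoordChange.hasSubst_linSubst (k := L) B
  -- `h = q + r`, `r ∈ 𝔪^{m+1}`
  have hr : h - ↑q ∈ maximalIdeal (MvPowerSeries (Fin n) L) ^ (m + 1) :=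
    Jets.sub_coe_truncTotal_mem_maximalIdeal_pow (m + 1) h
  have hsplit : MvPowerSeries.subst (FormalCoordChange.linSubst B) h =
      MvPowerSeries.subst (FormalCoordChange.linSubst B) (↑q : MvPowerSeries (Fin n) L) +
        MvPowerSeries.subst (FormalCoordChange.linSubst B) (h - (↑q : MvPowerSeries (Fin n) L)) := by
    rw [← MvPowerSeries.subst_add hsub, add_sub_cancel]
  -- the remainder contributes nothing in degree `m`
  have hrem : MvPowerSeries.coeff (Finsupp.single t m)
      (MvPowerSeries.subst (FormalCoordChange.linSubst B) (h - (↑q : MvPowerSeries (Fin n) L))) = 0 := by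
    have := Jets.algHom_apply_mem_maximalIdeal_pow (MvPowerSeries.substAlgHom hsub) hr
    rw [MvPowerSeries.substAlgHom_apply] at this
    exact Jets.coeff_eq_zero_of_mem_maximalIdeal_pow this (by simp)
  -- the polynomial part: `q(Bx)` is homogeneous of degree `m`
  let l : Fin n → MvPolynomial (Fin n) L := fun s => ∑ j, MvPolynomial.C (B s j) * MvPolynomial.X j
  have hl : ∀ s, (l s : MvPowerSeries (Fin n) L) = FormalCoordChange.linSubst B s := by
    intro s
    change MvPolynomial.coeToMvPowerSeries.ringHom (∑ j, MvPolynomial.C (B s j) * MvPolynomial.X j) = _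
    rw [map_sum]
    refine Finset.sum_congr rfl fun j _ => ?_
    rw [map_mul, MvPolynomial.coeToMvPowerSeries.ringHom_apply, MvPolynomial.coeToMvPowerSeries.ringHom_apply,
      MvPolynomial.coe_C, MvPolynomial.coe_X, MvPowerSeries.smul_eq_C_mul]
  have hpoly : MvPowerSeries.subst (FormalCoordChange.linSubst B) (↑q : MvPowerSeries (Fin n) L) =
      ↑(MvPolynomial.aeval l q) := by
    rw [MvPowerSeries.subst_coe q]
    have : (FormalCoordChange.linSubst B) = fun s => ((l s : MvPolynomial (Fin n) L) : MvPowerSeries (Fin n) L) :=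
      funext fun s => (hl s).symm
    rw [this]
    change MvPolynomial.aeval (fun s => MvPolynomial.coeToMvPowerSeries.algHom L (l s)) q = _
    rw [← MvPolynomial.comp_aeval, AlgHom.comp_apply]
    rfl
  have hqhom : q.IsHomogeneous m := by
    intro e he
    have he' : MvPolynomial.coeff e q ≠ 0 := he
    rw [hqdef, MvPowerSeries.coeff_truncTotal_eq_ite] at he'
    have hdeg : e.degree = m := by
      by_cases hlt : e.degree < m + 1
      · rw [if_pos hlt] at he'
        by_contra hne
        exact he' (hh e (by omega))
      · rw [if_neg hlt] at he'; exact absurd rfl he'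
    have : Finsupp.degree e = Finsupp.weight (1 : Fin n → ℕ) e :=
      congrArg (fun f => f e) (Finsupp.degree_eq_weight_one (R := ℕ) (σ := Fin n))
    rw [← this]; exact hdeg
  have hlhom : ∀ s, (l s).IsHomogeneous 1 := fun s => by
    refine MvPolynomial.IsHomogeneous.sum _ _ _ fun j _ => ?_
    simpa using (MvPolynomial.isHomogeneous_C _ (B s j)).mul (MvPolynomial.isHomogeneous_X L j)
  have haevalhom : (MvPolynomial.aeval l q).IsHomogeneous m := by
    simpa [one_mul] using hqhom.aeval l hlhom
  -- evaluation of the linear forms at `e_t`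
  have hli : ∀ i, MvPolynomial.aeval (Pi.single t (1 : L)) (l i) = B i t := by
    intro i
    change MvPolynomial.aeval (Pi.single t (1 : L)) (∑ j, MvPolynomial.C (B i j) * MvPolynomial.X j) = B i t
    rw [map_sum]
    simp_rw [map_mul, MvPolynomial.aeval_C, MvPolynomial.aeval_X, Algebra.algebraMap_self, RingHom.id_apply]
    rw [Finset.sum_eq_single t]
    · rw [Pi.single_eq_same, mul_one]
    · intro j _ hjt; rw [Pi.single_eq_of_ne hjt, mul_zero]
    · intro ht; exact absurd (Finset.mem_univ t) ht
  have haev : ∀ (x : Fin n → L) (p : MvPolynomial (Fin n) L), MvPolynomial.aeval x p = MvPolynomial.eval x p :=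
    fun x p => by rw [MvPolynomial.aeval_eq_eval₂Hom, Algebra.algebraMap_self]; rfl
  have hev : MvPolynomial.eval (Pi.single t (1 : L)) (MvPolynomial.aeval l q) =
      MvPolynomial.eval (fun s => B s t) q := by
    rw [← haev, ← AlgHom.comp_apply, MvPolynomial.comp_aeval]
    simp_rw [hli]
    rw [haev]
  rw [hsplit, map_add, hrem, add_zero, hpoly, MvPolynomial.coeff_coe, ← eval_single_one_eq_coeff haevalhom t, hev]

/-! ## 3. Initial forms along a centre `(p₁, p₂) ⊆ 𝔪` -/

/-- **The initial form of an element of `(p₁, p₂)^m` is a polynomial in the linear parts of `p₁, p₂`**: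
for `p₁, p₂ ∈ 𝔪` and `F ∈ (p₁, p₂)^m`, the value of `truncTotal (m+1) F` at `x + n` equals its value at
`x` whenever the linear parts of `p₁` and `p₂` vanish at `n` (Hironaka: the initial form of an
equimultiple element lies in `k[in P]`; Mulay 2.6/3.4 use this through the Weierstrass form).
[cite: Mulay1983, 2.6 and 3.4, pp. 410–411] -/
theorem eval_truncTotal_add_eq_of_mem_pow {p₁ p₂ : MvPowerSeries σ L}
    (hp₁ : MvPowerSeries.constantCoeff p₁ = 0) (hp₂ : MvPowerSeries.constantCoeff p₂ = 0) {n : σ → L}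
    (hn₁ : ∑ᶠ s : σ, MvPowerSeries.coeff (Finsupp.single s 1) p₁ * n s = 0)
    (hn₂ : ∑ᶠ s : σ, MvPowerSeries.coeff (Finsupp.single s 1) p₂ * n s = 0)
    {m : ℕ} {F : MvPowerSeries σ L} (hF : F ∈ (Ideal.span {p₁, p₂}) ^ m) (x : σ → L) :
    MvPolynomial.eval (x + n) (MvPowerSeries.truncTotal (m + 1) F) =
      MvPolynomial.eval x (MvPowerSeries.truncTotal (m + 1) F) := by
  classical
  haveI := Fintype.ofFinite σ
  -- orders
  have hI : Ideal.span {p₁, p₂} ≤ maximalIdeal (MvPowerSeries σ L) := by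
    rw [Ideal.span_le]
    rintro g hg
    simp only [Set.mem_insert_iff, Set.mem_singleton_iff] at hg
    rcases hg with rfl | rfl
    · exact Jets.mem_maximalIdeal_iff_constantCoeff_eq_zero.mpr hp₁
    · exact Jets.mem_maximalIdeal_iff_constantCoeff_eq_zero.mpr hp₂
  have hord : ∀ (i : ℕ) (G : MvPowerSeries σ L), G ∈ (Ideal.span {p₁, p₂}) ^ i → (i : ℕ∞) ≤ G.order :=
    fun i G hG => Jets.le_order_of_mem_maximalIdeal_pow (Ideal.pow_right_mono hI i hG)
  have hord1 : ∀ {p : MvPowerSeries σ L}, MvPowerSeries.constantCoeff p = 0 → ((1 : ℕ) : ℕ∞) ≤ p.order :=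
    fun hp => by exact_mod_cast MvPowerSeries.one_le_order_iff_constCoeff_eq_zero.mpr hp
  -- linear parts are additive and vanish at `n`
  have hlin : ∀ {p : MvPowerSeries σ L}, MvPowerSeries.constantCoeff p = 0 →
      (∑ᶠ s : σ, MvPowerSeries.coeff (Finsupp.single s 1) p * n s = 0) →
      MvPolynomial.eval (x + n) (MvPowerSeries.truncTotal 2 p) = MvPolynomial.eval x (MvPowerSeries.truncTotal 2 p) := by
    intro p hp hn
    rw [eval_truncTotal_two hp, eval_truncTotal_two hp]
    rw [finsum_eq_sum_of_fintype] at hn ⊢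
    rw [finsum_eq_sum_of_fintype]
    simp only [Pi.add_apply, mul_add, Finset.sum_add_distrib, hn, add_zero]
  -- induction along the powers of the ideal
  induction hF using Submodule.pow_induction_on_left' with
  | algebraMap r =>
    rw [Algebra.algebraMap_self, RingHom.id_apply, eval_truncTotal_one, eval_truncTotal_one]
  | add G G' i hG hG' ihG ihG' =>
    rw [map_add, map_add, map_add, ihG, ihG']
  | mem_mul s hs i G hG ih =>
    obtain ⟨a, b, rfl⟩ := Ideal.mem_span_pair.mp hs
    have hGo : (i : ℕ∞) ≤ G.order := hord i G hG
    have hpG : ∀ {p : MvPowerSeries σ L}, MvPowerSeries.constantCoeff p = 0 →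
        (∑ᶠ s : σ, MvPowerSeries.coeff (Finsupp.single s 1) p * n s = 0) →
        MvPolynomial.eval (x + n) (MvPowerSeries.truncTotal (i + 1 + 1) (p * G)) =
          MvPolynomial.eval x (MvPowerSeries.truncTotal (i + 1 + 1) (p * G)) := by
      intro p hp hpn
      have h := truncTotal_mul_of_le_order (hord1 hp) hGo
      rw [show 1 + i + 1 = i + 1 + 1 by ring] at h
      rw [h, (MvPolynomial.eval (x + n)).map_mul, (MvPolynomial.eval x).map_mul, hlin hp hpn, ih]
    have hpGo : ∀ {p : MvPowerSeries σ L}, MvPowerSeries.constantCoeff p = 0 →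
        ((i + 1 : ℕ) : ℕ∞) ≤ (p * G).order := by
      intro p hp
      calc ((i + 1 : ℕ) : ℕ∞) = (1 : ℕ) + (i : ℕ∞) := by push_cast; ring
        _ ≤ p.order + G.order := add_le_add (hord1 hp) hGo
        _ ≤ (p * G).order := MvPowerSeries.le_order_mul
    have hcG : ∀ (c : MvPowerSeries σ L) {p : MvPowerSeries σ L}, MvPowerSeries.constantCoeff p = 0 →
        (∑ᶠ s : σ, MvPowerSeries.coeff (Finsupp.single s 1) p * n s = 0) →
        MvPolynomial.eval (x + n) (MvPowerSeries.truncTotal (i + 1 + 1) (c * (p * G))) =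
          MvPolynomial.eval x (MvPowerSeries.truncTotal (i + 1 + 1) (c * (p * G))) := by
      intro c p hp hpn
      have h : MvPowerSeries.truncTotal (i + 1 + 1) (c * (p * G)) =
          MvPowerSeries.truncTotal 1 c * MvPowerSeries.truncTotal (i + 1 + 1) (p * G) := by
        have := truncTotal_mul_of_le_order (a := 0) (b := i + 1) (p := c) (F := p * G) (by simp) (hpGo hp)
        simpa only [zero_add, show 0 + (i + 1) + 1 = i + 1 + 1 by ring] using this
      rw [h, (MvPolynomial.eval (x + n)).map_mul, (MvPolynomial.eval x).map_mul, eval_truncTotal_one,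
        eval_truncTotal_one, hpG hp hpn]
    have hsplit : (a * p₁ + b * p₂) * G = a * (p₁ * G) + b * (p₂ * G) := by ring
    rw [hsplit, map_add, map_add, map_add, hcG a hp₁ hn₁, hcG b hp₂ hn₂]


end Mulay1983

end Literature.AlgebraicGeometry.Resolution
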